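import Summits.RiemannHypothesis.RiemannHypothesis.Theorems.WeilFormatCMixedArchAsymptotics
import Literature.NumberTheory.LFunctions.YoshidaWindowGramFrontDoorA
import HarnessLib

/-!
# Format C, design C∞: the odd sector's exact-arctan far diagonal is MONOTONE from the far threshold on

Route context: Fourier–Galerkin / Schur-complement certificates of Weil positivity on a window ("format C", C∞ door;
cell memo `run/shared/lean/pub/rh-explicit/rh-explicit-weil-10/KERNEL-LEVER.md` §23 addendum 3; supporting
stmt-RiemannHypothesis-0098; seat rh-explicit-weil-10).  The C∞ doors take one far floor `d₁o ≤ d̂⁻(k)` for all kernel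
indices `k ≥ m₀o` of the odd sector.  `WeilFormatCCinfFloors.cinf_hdle_odd` discharges it with the WORST-CASE Hilbert
penalty `π/4` (`devOdd0A`), which under-states the far floor by `π/4 − ½(π/2 − arctan √(Bo/(m₀o+1)))` (≈ 22 % of `d₁o` at
`a = 1`, `Bo = 96`, `m₀o = 512`).  This file proves that the exact-arctan diagonal
`devOddAA a A Bo k = ½(Re ψ(¼+iω_{k+1}/2) − log π) − 1/(8(k+1)) − a(1+E)/(π²(k+1)²) − ½(π/2 − arctan(√Bo/√(k+1))) − const`
is monotone in `k` from any `k₀` on with `Bo ≤ k₀+1`, `2a² ≤ k₀+1`, `2a ≤ π(k₀+1)` (the growth `½·Δlog` of the digamma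
term beats the growth of the arctan penalty, and the digamma-vs-log error `12/(5ω²)` of
`abs_reDigammaQuarter_sub_log_le_of_two_le` at both ends is absorbed by the first step `k₀ → k₀+1`), so a door may take
`d₁o ≤ devOddAA a A Bo m₀o` instead of `d₁o ≤ devOdd0A a A Bo m₀o`:

* `sub_arctan_mono`, `arctan_sub_arctan_le` — `arctan` is 1-Lipschitz on ordered pairs;
* `oddCore_arctan_mono` — the real-variable inequality behind the monotonicity;
* `devOddAA_mono` — `k₀ ≤ k → devOddAA a A Bo k₀ ≤ devOddAA a A Bo k`;
* `cinf_far_floor_odd_exact` — `d₁ ≤ devOddAA a A Bo m₀o → ∀ k ≥ m₀o, d₁ ≤ devOddAA a A Bo k`.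

Elementary real analysis; standard axioms; no RH claim.
-/

set_option linter.dupNamespace false
set_option autoImplicit false

noncomputable section

open Real

namespace Summit.RiemannHypothesis.RiemannHypothesis.Theorems.WeilFormatC

open Literature.NumberTheory.LFunctions Literature.NumberTheory.LFunctions.Yoshida1992
  Literature.NumberTheory.LFunctions.Yoshida1992.Encl Literature.Analysis.SpecialFunctions

/-- `x ↦ x − arctan x` is monotone (derivative `1 − 1/(1+x²) ≥ 0`). -/
theorem sub_arctan_mono : Monotone fun x : ℝ ↦ x - Real.arctan x := by
  have hd : ∀ x : ℝ, HasDerivAt (fun x : ℝ ↦ x - Real.arctan x) (1 - 1 / (1 + x ^ 2)) x :=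
    fun x ↦ (hasDerivAt_id x).sub (Real.hasDerivAt_arctan x)
  refine monotone_of_deriv_nonneg (fun x ↦ (hd x).differentiableAt) fun x ↦ ?_
  rw [(hd x).deriv]
  have h1 : (0 : ℝ) < 1 + x ^ 2 := by positivity
  rw [sub_nonneg, div_le_one h1]
  nlinarith [sq_nonneg x]

/-- `arctan u − arctan v ≤ u − v` for `v ≤ u`. -/
theorem arctan_sub_arctan_le {u v : ℝ} (h : v ≤ u) : Real.arctan u - Real.arctan v ≤ u - v := by
  have := sub_arctan_mono h
  simp only at this
  linarith

variable {a : ℝ}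

/-- **The real-variable core**: for `0 ≤ b ≤ y₀`, `1 ≤ y₀`, `2a² ≤ y₀`, `2a ≤ π y₀`, `y₀ + 1 ≤ y` and `0 ≤ c`,
`½(Re ψ(¼+iπy₀/(2a)) − log π) − 1/(8y₀) − c/(π²y₀²) − ½(π/2 − arctan(√b/√y₀))` is at most the same expression at `y`. -/
theorem oddCore_arctan_mono (ha : 0 < a) {b c y₀ y : ℝ} (hb0 : 0 ≤ b) (hb : b ≤ y₀) (hy₀1 : 1 ≤ y₀)
    (h2a : 2 * a ^ 2 ≤ y₀) (hω : 2 * a ≤ π * y₀) (hyy : y₀ + 1 ≤ y) (hc : 0 ≤ c) :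
    (reDigammaQuarter (π * y₀ / a) - Real.log π) / 2 - 1 / (8 * y₀) - c / (π ^ 2 * y₀ ^ 2)
        - (π / 2 - Real.arctan (Real.sqrt b / Real.sqrt y₀)) / 2
      ≤ (reDigammaQuarter (π * y / a) - Real.log π) / 2 - 1 / (8 * y) - c / (π ^ 2 * y ^ 2)
        - (π / 2 - Real.arctan (Real.sqrt b / Real.sqrt y)) / 2 := by
  have hy₀0 : 0 < y₀ := by linarith
  have hy0 : 0 < y := by linarith
  have hy₀y : y₀ ≤ y := by linarith
  -- frequencies
  set ω₀ : ℝ := π * y₀ / a with hω₀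
  set ω : ℝ := π * y / a with hωd
  have hω₀2 : 2 ≤ ω₀ := by rw [hω₀, le_div_iff₀ ha]; linarith
  have hωω : ω₀ ≤ ω := by
    rw [hω₀, hωd]; exact div_le_div_of_nonneg_right (mul_le_mul_of_nonneg_left hy₀y pi_pos.le) ha.le
  have hω2 : 2 ≤ ω := hω₀2.trans hωω
  have hω₀0 : 0 < ω₀ := by linarith
  -- (1) the digamma increment against the log increment
  have hR₀ := abs_reDigammaQuarter_sub_log_le_of_two_le hω₀2
  have hR := abs_reDigammaQuarter_sub_log_le_of_two_le hω2
  rw [abs_le] at hR₀ hR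
  have hlog : Real.log (ω / 2) - Real.log (ω₀ / 2) = Real.log (y / y₀) := by
    rw [← Real.log_div (by positivity) (by positivity)]
    congr 1
    rw [hω₀, hωd]; field_simp
  have herr : 12 / (5 * ω ^ 2) ≤ 12 / (5 * ω₀ ^ 2) := by
    apply div_le_div_of_nonneg_left (by norm_num) (by positivity)
    exact mul_le_mul_of_nonneg_left (pow_le_pow_left₀ hω₀0.le hωω 2) (by norm_num)
  have hΔR : Real.log (y / y₀) - 24 / (5 * ω₀ ^ 2) ≤ reDigammaQuarter ω - reDigammaQuarter ω₀ := by
    have e : (24 : ℝ) / (5 * ω₀ ^ 2) = 12 / (5 * ω₀ ^ 2) + 12 / (5 * ω₀ ^ 2) := by ring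
    linarith [hR.1, hR₀.2]
  -- (2) the arctan penalty increment, p = √y₀/√y
  set p : ℝ := Real.sqrt y₀ / Real.sqrt y with hp
  have hsy₀ : 0 < Real.sqrt y₀ := Real.sqrt_pos.mpr hy₀0
  have hsy : 0 < Real.sqrt y := Real.sqrt_pos.mpr hy0
  have hp0 : 0 < p := by positivity
  have hp1 : p ≤ 1 := by
    rw [hp, div_le_one hsy]; exact Real.sqrt_le_sqrt hy₀y
  have hp2 : p ^ 2 = y₀ / y := by
    rw [hp, div_pow, Real.sq_sqrt hy₀0.le, Real.sq_sqrt hy0.le]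
  have hpen : Real.arctan (Real.sqrt b / Real.sqrt y₀) - Real.arctan (Real.sqrt b / Real.sqrt y) ≤ 1 - p := by
    have hB0 : 0 ≤ Real.sqrt b := Real.sqrt_nonneg _
    have hBy : Real.sqrt b ≤ Real.sqrt y₀ := Real.sqrt_le_sqrt hb
    have hvu : Real.sqrt b / Real.sqrt y ≤ Real.sqrt b / Real.sqrt y₀ :=
      div_le_div_of_nonneg_left hB0 hsy₀ (Real.sqrt_le_sqrt hy₀y)
    refine (arctan_sub_arctan_le hvu).trans ?_
    have hinv : 0 ≤ 1 / Real.sqrt y₀ - 1 / Real.sqrt y := by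
      rw [sub_nonneg]; exact one_div_le_one_div_of_le hsy₀ (Real.sqrt_le_sqrt hy₀y)
    have e1 : Real.sqrt b / Real.sqrt y₀ - Real.sqrt b / Real.sqrt y
        = Real.sqrt b * (1 / Real.sqrt y₀ - 1 / Real.sqrt y) := by ring
    have e2 : 1 - p = Real.sqrt y₀ * (1 / Real.sqrt y₀ - 1 / Real.sqrt y) := by
      rw [hp]; field_simp
    rw [e1, e2]
    exact mul_le_mul_of_nonneg_right hBy hinv
  -- (3) log(y/y₀) ≥ 2(1 − p) and 1 − p ≥ 1/(2(y₀+1))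
  have hlogp : 2 * (1 - p) ≤ Real.log (y / y₀) := by
    have hl := Real.log_le_sub_one_of_pos hp0
    have e1 : Real.log (p ^ 2) = 2 * Real.log p := by rw [Real.log_pow]; norm_num
    have e2 : Real.log (y / y₀) = -Real.log (y₀ / y) := by rw [← Real.log_inv, inv_div]
    have e : Real.log (y / y₀) = -(2 * Real.log p) := by rw [e2, ← hp2, e1]
    rw [e]; linarith
  have h1p : 1 / (2 * (y₀ + 1)) ≤ 1 - p := by
    have hq : 1 - p ^ 2 ≤ 2 * (1 - p) := by nlinarith
    have ht : 1 / (y₀ + 1) ≤ 1 - p ^ 2 := by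
      rw [hp2]
      have h1 : y₀ / y ≤ y₀ / (y₀ + 1) := div_le_div_of_nonneg_left hy₀0.le (by linarith) hyy
      have h2 : 1 - y₀ / (y₀ + 1) = 1 / (y₀ + 1) := by field_simp; ring
      linarith
    have e : 1 / (2 * (y₀ + 1)) = (1 / (y₀ + 1)) / 2 := by field_simp
    rw [e]; linarith
  -- (4) the error budget: 24/(5ω₀²) ≤ 1/(2(y₀+1))
  have hbudget : 24 / (5 * ω₀ ^ 2) ≤ 1 / (2 * (y₀ + 1)) := by
    have hπ : (3.14 : ℝ) < π := Real.pi_gt_d2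
    have ha2 : 0 < a ^ 2 := by positivity
    have hππ : (3.14 : ℝ) * 3.14 < π * π := mul_lt_mul'' hπ hπ (by norm_num) (by norm_num)
    have h3 : (48 : ℝ) ≤ 5 * π ^ 2 := by nlinarith
    have h48 : 48 * a ^ 2 ≤ 24 * y₀ := by linarith
    have k1 : 48 * a ^ 2 * (y₀ + 1) ≤ 24 * y₀ * (y₀ + 1) :=
      mul_le_mul_of_nonneg_right h48 (by linarith)
    have k2 : 24 * y₀ * (y₀ + 1) ≤ 48 * y₀ ^ 2 := by nlinarith
    have k3 : 48 * y₀ ^ 2 ≤ 5 * π ^ 2 * y₀ ^ 2 := mul_le_mul_of_nonneg_right h3 (sq_nonneg y₀)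
    have key : 48 * a ^ 2 * (y₀ + 1) ≤ 5 * π ^ 2 * y₀ ^ 2 := k1.trans (k2.trans k3)
    have eω : 5 * ω₀ ^ 2 = 5 * π ^ 2 * y₀ ^ 2 / a ^ 2 := by rw [hω₀]; field_simp
    rw [eω, div_le_div_iff₀ (by positivity) (by positivity), one_mul, le_div_iff₀ ha2]
    have e : 24 * (2 * (y₀ + 1)) * a ^ 2 = 48 * a ^ 2 * (y₀ + 1) := by ring
    rw [e]; exact key
  -- (5) the two small monotone terms and assembly
  have hm1 : 1 / (8 * y) ≤ 1 / (8 * y₀) :=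
    one_div_le_one_div_of_le (by positivity) (by linarith)
  have hm2 : c / (π ^ 2 * y ^ 2) ≤ c / (π ^ 2 * y₀ ^ 2) :=
    div_le_div_of_nonneg_left hc (by positivity)
      (mul_le_mul_of_nonneg_left (pow_le_pow_left₀ hy₀0.le hy₀y 2) (by positivity))
  linarith [hΔR, hpen, hlogp, h1p, hbudget, hm1, hm2]

/-- **Monotonicity of the odd exact-arctan far diagonal.**  For `Bo ≤ k₀+1`, `2a² ≤ k₀+1`, `2a ≤ π(k₀+1)` and
`k₀ ≤ k`: `devOddAA a A Bo k₀ ≤ devOddAA a A Bo k`. -/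
theorem devOddAA_mono (ha : 0 < a) (A : ℝ) {Bo k₀ k : ℕ} (hBo : (Bo : ℝ) ≤ (k₀ : ℝ) + 1)
    (h2a : 2 * a ^ 2 ≤ (k₀ : ℝ) + 1) (hω : 2 * a ≤ π * ((k₀ : ℝ) + 1)) (hk : k₀ ≤ k) :
    devOddAA a A Bo k₀ ≤ devOddAA a A Bo k := by
  rcases Nat.eq_or_lt_of_le hk with rfl | hlt
  · exact le_rfl
  have hfreq : ∀ n : ℕ, freq a ((n : ℤ) + 1) = π * ((n : ℝ) + 1) / a := by
    intro n; rw [freq]; push_cast; ring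
  have hk1 : (k₀ : ℝ) + 1 + 1 ≤ (k : ℝ) + 1 := by
    have : (k₀ : ℝ) + 1 ≤ k := by exact_mod_cast hlt
    linarith
  have hk₀ : (1 : ℝ) ≤ (k₀ : ℝ) + 1 := by
    have : (0 : ℝ) ≤ k₀ := Nat.cast_nonneg _
    linarith
  have hE : 0 < weilArchDensity (2 * a) := weilArchDensity_pos (by positivity)
  have hC : 0 ≤ a * (1 + weilArchDensity (2 * a)) := by positivity
  have hcore := oddCore_arctan_mono ha (Nat.cast_nonneg Bo) hBo hk₀ h2a hω hk1 hC
  unfold devOddAA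
  rw [hfreq k₀, hfreq k]
  linarith

/-- **The odd far floor with the exact arctan penalty**: `d₁ ≤ devOddAA a A Bo m₀o` gives `d₁ ≤ devOddAA a A Bo k` for every
kernel index `k ≥ m₀o` (`Bo ≤ m₀o+1`, `2a² ≤ m₀o+1`, `2a ≤ π(m₀o+1)`) — the `hde₃/hdlo` input of the C∞ doors without `π/4`. -/
theorem cinf_far_floor_odd_exact (ha : 0 < a) (A : ℝ) {Bo m₀o : ℕ} (hBo : (Bo : ℝ) ≤ (m₀o : ℝ) + 1)
    (h2a : 2 * a ^ 2 ≤ (m₀o : ℝ) + 1) (hω : 2 * a ≤ π * ((m₀o : ℝ) + 1)) {d₁ : ℝ}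
    (hd₁ : d₁ ≤ devOddAA a A Bo m₀o) : ∀ k : ℕ, m₀o ≤ k → d₁ ≤ devOddAA a A Bo k :=
  fun _ hk ↦ hd₁.trans (devOddAA_mono ha A hBo h2a hω hk)

end Summit.RiemannHypothesis.RiemannHypothesis.Theorems.WeilFormatC

end
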